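import Summits.RiemannHypothesis.RiemannHypothesis.Theorems.SignConeConeMagnificationCombTypeSharpBounds

/-!
# Crux `SignCone.ConeMagnification` (stmt-RiemannHypothesis-16303), line `Sketch` r9, stub `stub_combType` — sharp node evaluation IX:
# the SHARP node data of a pair (window `√(log M)/M`): class term, per-node errors, and their sum against `c + Λ`

Backstop, part 9 — the residual `hsharp` of seat-0's F4 (`…StubCombType`).  For a `C²` bump autocorrelation `B ≥ 0`, `L ≥ 1` and a weight
`c ≥ 0` with `Σ_{n ≤ N} c ≤ AN`, there are `E₁ ≥ 0` and `M₁` such that for `M ≥ M₁`, `M ≥ 4096L²` and every pair `ℓ, ℓ' ≤ L` the class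
term `S` of `CombType.node_sharp_main` and the per-node errors `err` (main range: `e₀ + e₁/n`, `CombType.node_sharp_main`; corners:
`(C₃ + S_max)/n + 8N₀Lh`, `CombType.node_sharp_corner`) satisfy `|S| ≤ E₁(log M)^{3/4}`, `Σ_{n ≤ 3LM}(c+Λ)err ≤ E₁(log M)^{3/4}` and the
per-node sharp bound — `CombType.sharp_node_data`.  The sums use `sum_mul_error_le` (main range) and
`CombType.sum_div_Ioc_le_of_chebyshev` (corners, threshold `n₁ = ⌊M/(8κL²)⌋`); with `κ = √(log M)` every contribution is
`O(κ log κ + (log M)/κ) = O((log M)^{3/4})`.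
-/

noncomputable section

-- `Summit.RiemannHypothesis.RiemannHypothesis.…` repeats a namespace component by design (D-0017 layout).
set_option linter.dupNamespace false

open scoped BigOperators ArithmeticFunction.vonMangoldt
open MeasureTheory Set

namespace Summit.RiemannHypothesis.RiemannHypothesis.Theorems.SignConeConeMagnification

open Literature.NumberTheory.LFunctions

namespace CombType

set_option maxHeartbeats 1600000 in
/-- **The sharp node data of a pair** (window `√(log M)/M`).  See the module docstring. [folklore] -/
theorem sharp_node_data {B B' B'' : ℝ → ℝ} {N₀ N₁ N₂ : ℝ} {L : ℕ}
    (hB : ∀ x, HasDerivAt B (B' x) x) (hB' : ∀ x, HasDerivAt B' (B'' x) x)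
    (h0 : ∀ x, |B x| ≤ N₀) (h1 : ∀ x, |B' x| ≤ N₁) (h2 : ∀ x, |B'' x| ≤ N₂)
    (hBs : ∀ x, 2 < |x| → B x = 0) (hB0 : ∀ x, 0 ≤ B x) (hL : 1 ≤ L)
    {c : ℕ → ℝ} (hc0 : ∀ n, 0 ≤ c n) {A : ℝ} (hA : ∀ N : ℕ, 1 ≤ N → ∑ n ∈ Finset.Icc 1 N, c n ≤ A * N) :
    ∃ E₁ : ℝ, 0 ≤ E₁ ∧ ∃ M₁ : ℕ, ∀ M : ℕ, M₁ ≤ M → 4096 * L ^ 2 ≤ M → ∀ ℓ ∈ Finset.Icc 1 L, ∀ ℓ' ∈ Finset.Icc 1 L,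
      ∃ S err : ℕ → ℝ, (∀ δ, |S δ| ≤ E₁ * Real.log M ^ (3 / 4 : ℝ)) ∧
        (∑ n ∈ Finset.Icc 1 (3 * L * M), (c n + Λ n) * err n ≤ E₁ * Real.log M ^ (3 / 4 : ℝ)) ∧
        ∀ n ∈ Finset.Icc 1 (3 * L * M),
          |(∑ k' ∈ Finset.Icc 1 M,
              (∑ k ∈ Finset.Icc 1 M, B ((Real.log ((n : ℝ) * ℓ' * k' / ℓ) - Real.log k) / (Real.sqrt (Real.log M) / M))
                / Real.sqrt k) / Real.sqrt k' / Real.sqrt n)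
            - B 0 * (Real.sqrt ℓ / Real.sqrt ℓ') *
                (∑ k' ∈ Finset.Icc 1 ⌊1 / (4 * (Real.sqrt (Real.log M) / M)) / ((n : ℝ) * ℓ')⌋₊,
                  (if ℓ ∣ n * ℓ' * k' then 1 / (k' : ℝ) else 0)) / n
            - (Real.sqrt (Real.log M) / M) *
                (∫ v, B v * Real.exp (-((Real.sqrt (Real.log M) / M) * v) / 2)) * (Real.sqrt ℓ' / Real.sqrt ℓ) *
                ((min M ⌊(ℓ : ℝ) * M * Real.exp (-(2 * (Real.sqrt (Real.log M) / M))) / (ℓ' * n)⌋₊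
                    - ⌊1 / (4 * (Real.sqrt (Real.log M) / M)) / ((n : ℝ) * ℓ')⌋₊ : ℕ) : ℝ)
            - S (Nat.gcd (n * ℓ') ℓ) / n| ≤ err n := by
  classical
  have hN₀ : 0 ≤ N₀ := (abs_nonneg _).trans (h0 0)
  have hN₁ : 0 ≤ N₁ := (abs_nonneg _).trans (h1 0)
  have hN₂ : 0 ≤ N₂ := (abs_nonneg _).trans (h2 0)
  have hLR : (1 : ℝ) ≤ L := by exact_mod_cast hL
  have hA0 : 0 ≤ A := by
    have := hA 1 le_rfl
    simp only [Finset.Icc_self, Finset.sum_singleton, Nat.cast_one, mul_one] at this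
    exact (hc0 1).trans this
  -- constants
  set A' : ℝ := A + (Real.log 4 + 4) with hA'
  have hlog4 : 0 ≤ Real.log 4 := Real.log_nonneg (by norm_num)
  have hA'0 : 0 ≤ A' := by rw [hA']; positivity
  set C₂ : ℝ := (N₀ + 2 * N₁ + N₂) * (96 + 192 * L) * L ^ 2 with hC₂
  set C₃ : ℝ := 8 * C₂ * L + 64 * N₀ * L ^ 2 with hC₃
  set Smax : ℝ := Real.sqrt L * (2 * N₀ * L + 5 * N₂ + 6 * N₀) with hSmax
  set Ke₀ : ℝ := (32 * N₁ + 28 * N₀) * (1 + 7 * Real.sqrt L) + 48 * N₀ with hKe₀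
  set Ke₁ : ℝ := 9 * L ^ 3 * (3072 * N₁ + 264 * N₀) + 9 * L * (192 * N₁ + 12 * N₀) + 2 * (4 * C₂ + 10 * N₂) * L ^ 2 with hKe₁
  set Kc : ℝ := (C₃ + Smax) * (2 + 24 * L ^ 3) + 24 * N₀ * L ^ 2 with hKc
  have hC₂0 : 0 ≤ C₂ := by positivity
  have hC₃0 : 0 ≤ C₃ := by positivity
  have hSmax0 : 0 ≤ Smax := by positivity
  have hKe₀0 : 0 ≤ Ke₀ := by positivity
  have hKe₁0 : 0 ≤ Ke₁ := by positivity
  have hKc0 : 0 ≤ Kc := by positivity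
  refine ⟨Smax + A' * (Ke₀ + Ke₁ + Kc), by positivity, max ⌈Real.exp (4 * L ^ 2)⌉₊ (4 * L ^ 4), ?_⟩
  intro M hM₁ hM4096 ℓ hℓ ℓ' hℓ'
  obtain ⟨hℓ1, hℓL⟩ := Finset.mem_Icc.1 hℓ
  obtain ⟨hℓ'1, hℓ'L⟩ := Finset.mem_Icc.1 hℓ'
  obtain ⟨hlog1, hκ1, hκlog, hh0, hhL, hhM1, hhM2, hh2, hYeq, hY1, hY2⟩ := comb_params_of_large hL hM4096
  set κ : ℝ := Real.sqrt (Real.log M) with hκdef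
  set h : ℝ := κ / M with hhdef
  set R : ℝ := Real.log M ^ (3 / 4 : ℝ) with hRdef
  obtain ⟨hR1, hκR, hsκR, hκsq⟩ := logpow_facts hlog1
  rw [← hκdef] at hκR hsκR hκsq
  rw [← hRdef] at hR1 hκR hsκR
  have hMpos : 0 < M := by
    have : 1 ≤ 4096 * L ^ 2 := by nlinarith
    omega
  have hMR : (0 : ℝ) < M := by exact_mod_cast hMpos
  have hM1 : (1 : ℝ) ≤ M := by exact_mod_cast hMpos
  have hhM : h * M = κ := by rw [hhdef]; field_simp
  have hκ0 : 0 < κ := by linarith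
  -- the two thresholds
  have hexp : Real.exp (4 * (L : ℝ) ^ 2) ≤ M := by
    have h1 : (⌈Real.exp (4 * (L : ℝ) ^ 2)⌉₊ : ℝ) ≤ M := by exact_mod_cast le_of_max_le_left hM₁
    exact (Nat.le_ceil _).trans h1
  have hM4 : 4 * (L : ℝ) ^ 4 ≤ M := by exact_mod_cast le_of_max_le_right hM₁
  have hκL : 2 * (L : ℝ) ≤ h * M := by
    rw [hhM, hκdef]
    have hlogM : 4 * (L : ℝ) ^ 2 ≤ Real.log M := by
      rw [Real.le_log_iff_exp_le hMR]; exact hexp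
    rw [show (2 * (L : ℝ)) = Real.sqrt ((2 * L) ^ 2) from (Real.sqrt_sq (by positivity)).symm]
    exact Real.sqrt_le_sqrt (by nlinarith)
  obtain ⟨hn₁1, hn₁N, hlogcorner⟩ := mainRange_threshold (L := L) (M := M) hL hκ1 hMR hY1 hM4
  set n₁ : ℕ := ⌊1 / (8 * (κ / M) * L ^ 2)⌋₊ with hn₁
  have hn₁y : (n₁ : ℝ) ≤ 1 / (8 * h * L ^ 2) := by rw [hhdef]; exact Nat.floor_le (by positivity)
  have hn₁lt : 1 / (8 * h * L ^ 2) < n₁ + 1 := by rw [hhdef]; exact Nat.lt_floor_add_one _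
  have hn₁R : (1 : ℝ) ≤ n₁ := by exact_mod_cast hn₁1
  have hn₁M : (n₁ : ℝ) ≤ M := by
    refine hn₁y.trans ?_
    rw [div_le_iff₀ (by positivity), hhdef]
    have : (1 : ℝ) ≤ 8 * κ * L ^ 2 := by nlinarith
    calc (1 : ℝ) ≤ 8 * κ * L ^ 2 := this
      _ = M * (8 * (κ / M) * L ^ 2) := by field_simp
  -- the Chebyshev weight `c + Λ`
  have hf0 : ∀ n, 0 ≤ c n + Λ n := fun n => add_nonneg (hc0 n) ArithmeticFunction.vonMangoldt_nonneg
  have hfA : ∀ N : ℕ, 1 ≤ N → ∑ n ∈ Finset.Icc 1 N, (c n + Λ n) ≤ A' * N := by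
    intro N hN
    rw [Finset.sum_add_distrib, hA', add_mul]
    exact add_le_add (hA N hN) (Montgomery.sum_Icc_vonMangoldt_le N)
  -- the class term and the errors
  set e₀ : ℝ := h * L ^ 2 * ((32 * N₁ + 28 * N₀) * (1 + 7 * Real.sqrt (h * M * L)) + 48 * N₀) with he₀
  set e₁ : ℝ := h * (h * M) * L ^ 3 * (3072 * N₁ + 264 * N₀) + h * (1 + Real.log M) * L * (192 * N₁ + 12 * N₀)
    + (4 * C₂ + 10 * N₂) * L ^ 2 / (h * M) with he₁
  have he₀0 : 0 ≤ e₀ := by positivity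
  have hlogM0 : 0 ≤ Real.log (M : ℝ) := Real.log_nonneg hM1
  have he₁0 : 0 ≤ e₁ := by positivity
  set S : ℕ → ℝ := fun δ => if δ ≤ ℓ then
      (Real.sqrt ℓ / Real.sqrt ℓ') * ((δ : ℝ) / ℓ) *
          (B 0 * Real.log (2 * (δ : ℝ)) + (∫ v in Ioi (1 / 2 : ℝ), ((∑' m : ℤ, B (m / v)) - v * ∫ x, B x) / v)
            - (∫ x, B x) / 2)
        + (∫ v, B v * Real.exp (-(h * v) / 2)) * (Real.sqrt ℓ' / Real.sqrt ℓ) / (4 * ℓ')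
    else 0 with hSdef
  set err : ℕ → ℝ := fun n => if 8 * h * L ^ 2 * n ≤ 1 then e₀ + e₁ / n else (C₃ + Smax) / n + 8 * N₀ * L * h with herrdef
  have h32 : 1 / (32 * (L : ℝ)) ≤ 1 / 32 := one_div_le_one_div_of_le (by norm_num) (by linarith)
  have hh4 : h ≤ 1 / 4 := by linarith
  refine ⟨S, err, ?_, ?_, ?_⟩
  · -- (1) the class term
    intro δ
    simp only [hSdef]
    split_ifs with hδ
    · refine (abs_classTerm_le (h := h) hB hB' h0 h2 hBs hB0 hℓ1 hℓL hℓ'1 hℓ'L hδ hh0.le hh4).trans ?_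
      rw [← hSmax]
      have : Smax * 1 ≤ (Smax + A' * (Ke₀ + Ke₁ + Kc)) * R :=
        mul_le_mul (by nlinarith) hR1 zero_le_one (by positivity)
      linarith
    · rw [abs_zero]; positivity
  · -- (2) the error sum
    have hIcc : ∀ N : ℕ, Finset.Icc 1 N = Finset.Ioc 0 N := fun N => by
      ext k; simp only [Finset.mem_Icc, Finset.mem_Ioc]; omega
    have hsplit : ∑ n ∈ Finset.Icc 1 (3 * L * M), (c n + Λ n) * err n
        = ∑ n ∈ Finset.Icc 1 n₁, (c n + Λ n) * err n + ∑ n ∈ Finset.Ioc n₁ (3 * L * M), (c n + Λ n) * err n := by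
      rw [hIcc, hIcc, ← Finset.sum_Ioc_consecutive _ (Nat.zero_le n₁) hn₁N]
    have hmainEq : ∑ n ∈ Finset.Icc 1 n₁, (c n + Λ n) * err n = ∑ n ∈ Finset.Icc 1 n₁, (c n + Λ n) * (e₀ + e₁ / n) := by
      refine Finset.sum_congr rfl fun n hn => ?_
      have hnle : (n : ℝ) ≤ n₁ := by exact_mod_cast (Finset.mem_Icc.1 hn).2
      have hcond : 8 * h * L ^ 2 * n ≤ 1 := by
        have : 8 * h * (L : ℝ) ^ 2 * n ≤ 8 * h * L ^ 2 * n₁ := mul_le_mul_of_nonneg_left hnle (by positivity)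
        have h' : 8 * h * (L : ℝ) ^ 2 * n₁ ≤ 1 := by
          have := mul_le_mul_of_nonneg_left hn₁y (by positivity : (0 : ℝ) ≤ 8 * h * L ^ 2)
          rwa [mul_one_div_cancel (by positivity)] at this
        linarith
      simp only [herrdef, if_pos hcond]
    have hcornerEq : ∑ n ∈ Finset.Ioc n₁ (3 * L * M), (c n + Λ n) * err n
        = ∑ n ∈ Finset.Ioc n₁ (3 * L * M), (c n + Λ n) * ((C₃ + Smax) / n + 8 * N₀ * L * h) := by
      refine Finset.sum_congr rfl fun n hn => ?_
      have hnlt : (n₁ : ℝ) + 1 ≤ n := by exact_mod_cast (Finset.mem_Ioc.1 hn).1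
      have hcond : ¬ (8 * h * L ^ 2 * n ≤ 1) := by
        intro hc
        have : 8 * h * (L : ℝ) ^ 2 * (n₁ + 1) ≤ 1 := le_trans (mul_le_mul_of_nonneg_left hnlt (by positivity)) hc
        have h' : 1 < 8 * h * (L : ℝ) ^ 2 * (n₁ + 1) := by
          have := mul_lt_mul_of_pos_left hn₁lt (by positivity : (0 : ℝ) < 8 * h * L ^ 2)
          rwa [mul_one_div_cancel (by positivity)] at this
        linarith
      simp only [herrdef, if_neg hcond]
    have hmain := sum_main_errors_le hf0 hfA he₀0 he₁0 hn₁1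
    have hcorner := sum_corner_errors_le (C := C₃ + Smax) (D := 8 * N₀ * L * h) hf0 hfA (by positivity) (by positivity) hn₁1 hn₁N
    rw [hsplit, hmainEq, hcornerEq]
    refine (add_le_add hmain hcorner).trans ?_
    -- numeric bounds
    have hlogn₁ : Real.log (n₁ : ℝ) ≤ Real.log M := Real.log_le_log (by linarith) hn₁M
    have hsq9 : (1 + Real.log (M : ℝ)) ^ 2 ≤ 9 * M := one_add_log_sq_le hM1
    have hn₁h : h * (n₁ : ℝ) ≤ 1 / (8 * L ^ 2) := by
      have := mul_le_mul_of_nonneg_left hn₁y hh0.le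
      rw [show h * (1 / (8 * h * (L : ℝ) ^ 2)) = 1 / (8 * L ^ 2) by field_simp] at this
      exact this
    have ha := bound_e0 (κ := κ) (Lr := (L : ℝ)) (N₀ := N₀) (N₁ := N₁) (A' := A') (R := R) hLR hA'0 hN₀ hN₁ hκ0.le hR1 hsκR
      hn₁h
    rw [← hhM] at ha
    have hb := bound_e1 (Lr := (L : ℝ)) (C₂ := C₂) (N₀ := N₀) (N₁ := N₁) (N₂ := N₂) (A' := A') (R := R)
      (lgn := Real.log (n₁ : ℝ)) hMR hκ1 hhdef hκsq hlogM0 hsq9 hκR hR1 hlogn₁ hLR hA'0 hN₀ hN₁ hN₂ hC₂0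
    have hpush : ((3 * L * M : ℕ) : ℝ) = 3 * L * M := by push_cast; ring
    rw [hpush] at hlogcorner
    have hc := bound_corner (Lr := (L : ℝ)) (N₀ := N₀) (A' := A') (R := R) (C := C₃ + Smax)
      (lgN := Real.log (3 * (L : ℝ) * M)) (lgn := Real.log ((n₁ : ℝ) + 1)) hMR hκ0 hhdef hκR hR1 hLR hA'0 hN₀ (by positivity)
      hlogcorner
    rw [hpush]
    have htot : A' * Ke₀ * R + A' * Ke₁ * R + A' * Kc * R ≤ (Smax + A' * (Ke₀ + Ke₁ + Kc)) * R := by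
      have : 0 ≤ Smax * R := by positivity
      have e : (Smax + A' * (Ke₀ + Ke₁ + Kc)) * R = Smax * R + (A' * Ke₀ * R + A' * Ke₁ * R + A' * Kc * R) := by ring
      linarith
    have ha' : e₀ * (A' * n₁) ≤ A' * Ke₀ * R := by rw [he₀, hKe₀]; exact ha
    have hb' : e₁ * (A' * (1 + Real.log n₁)) ≤ A' * Ke₁ * R := by rw [he₁, hKe₁]; exact hb
    have hc' : (C₃ + Smax) * (A' * (2 + Real.log (3 * (L : ℝ) * M) - Real.log (n₁ + 1))) + 8 * N₀ * L * h * (A' * (3 * L * M))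
        ≤ A' * Kc * R := by rw [hKc]; exact hc
    linarith [ha', hb', hc', htot, hmain, hcorner]
  · -- (3) the per-node bound
    intro n hn
    obtain ⟨hn1, hn3⟩ := Finset.mem_Icc.1 hn
    have hgcd : Nat.gcd (n * ℓ') ℓ ≤ ℓ := Nat.gcd_le_right _ (by omega)
    have hSn : S (Nat.gcd (n * ℓ') ℓ) = (Real.sqrt ℓ / Real.sqrt ℓ') * (((Nat.gcd (n * ℓ') ℓ : ℕ) : ℝ) / ℓ) *
          (B 0 * Real.log (2 * ((Nat.gcd (n * ℓ') ℓ : ℕ) : ℝ))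
            + (∫ v in Ioi (1 / 2 : ℝ), ((∑' m : ℤ, B (m / v)) - v * ∫ x, B x) / v) - (∫ x, B x) / 2)
        + (∫ v, B v * Real.exp (-(h * v) / 2)) * (Real.sqrt ℓ' / Real.sqrt ℓ) / (4 * ℓ') := by
      simp only [hSdef, if_pos hgcd]
    rw [hSn]
    by_cases hcase : 8 * h * L ^ 2 * n ≤ 1
    · have hm := node_sharp_main (M := M) (n := n) hB hB' h0 h1 h2 hBs hB0 hL hℓ1 hℓL hℓ'1 hℓ'L hn1 hh0 hhL hhM1 hκL hcase
      simp only [herrdef, if_pos hcase]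
      exact hm
    · have hm := node_sharp_corner (M := M) (n := n) hB hB' h0 h1 h2 hBs hB0 hL hℓ1 hℓL hℓ'1 hℓ'L hn1 hh0 hhL hhM1 hhM2
      simp only [herrdef, if_neg hcase]
      exact hm

/-- **Anchor `combTypeSharpNodeData`** (registered sub-goal; `sharp_node_data` with explicit quantifiers): the sharp node data of a pair
— the residual `hsharp` of the `stub_combType` assembly. [folklore] -/
theorem combTypeSharpNodeData : ∀ B B' B'' : ℝ → ℝ, ∀ N₀ N₁ N₂ : ℝ, ∀ L : ℕ, (∀ x, HasDerivAt B (B' x) x) → (∀ x, HasDerivAt B' (B'' x) x) → (∀ x, |B x| ≤ N₀) → (∀ x, |B' x| ≤ N₁) → (∀ x, |B'' x| ≤ N₂) → (∀ x, 2 < |x| → B x = 0) → (∀ x, 0 ≤ B x) → (1 ≤ L) → ∀ c : ℕ → ℝ, (∀ n, 0 ≤ c n) → ∀ A : ℝ, (∀ N : ℕ, 1 ≤ N → ∑ n ∈ Finset.Icc 1 N, c n ≤ A * N) → ∃ E₁ : ℝ, 0 ≤ E₁ ∧ ∃ M₁ : ℕ, ∀ M : ℕ, M₁ ≤ M → 4096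 * L ^ 2 ≤ M → ∀ ℓ ∈ Finset.Icc 1 L, ∀ ℓ' ∈ Finset.Icc 1 L, ∃ S err : ℕ → ℝ, (∀ δ, |S δ| ≤ E₁ * Real.log M ^ (3 / 4 : ℝ)) ∧ (∑ n ∈ Finset.Icc 1 (3 * L * M), (c n + ArithmeticFunction.vonMangoldt n) * err n ≤ E₁ * Real.log M ^ (3 / 4 : ℝ)) ∧ ∀ n ∈ Finset.Icc 1 (3 * L * M), |(∑ k' ∈ Finset.Icc 1 M, (∑ k ∈ Finset.Icc 1 M, B ((Real.log ((n : ℝ) * ℓ' * k' / ℓ) - Real.log k) / (Real.sqrt (Real.log M) / M)) / Real.sqrt k) / Real.sqrt k' / Real.sqrt n) - B 0 * (Real.sqrt ℓ / Real.sqrt ℓ') * (∑ k' ∈ Finset.Icc 1 ⌊1 / (4 * (Real.sqrt (Real.log M) / M)) / ((n : ℝ) * ℓ')⌋₊, (if ℓ ∣ n * ℓ' * k' then 1 / (k' : ℝ) else 0)) / n - (Real.sqrt (Real.log M) / M) * (∫ v, B v * Real.exp (-((Real.sqrt (Real.log M) / M) * v) / 2)) * (Real.sqrt ℓ' / Real.sqrt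 ℓ) * ((min M ⌊(ℓ : ℝ) * M * Real.exp (-(2 * (Real.sqrt (Real.log M) / M))) / (ℓ' * n)⌋₊ - ⌊1 / (4 * (Real.sqrt (Real.log M) / M)) / ((n : ℝ) * ℓ')⌋₊ : ℕ) : ℝ) - S (Nat.gcd (n * ℓ') ℓ) / n| ≤ err n :=
  fun _ _ _ _ _ _ _ hB hB' h0 h1 h2 hBs hB0 hL _ hc0 _ hA => sharp_node_data hB hB' h0 h1 h2 hBs hB0 hL hc0 hA

end CombType

end Summit.RiemannHypothesis.RiemannHypothesis.Theorems.SignConeConeMagnification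

end
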